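/-
Copyright (c) 2026. All rights reserved.
Released under Apache 2.0 license as described in the file LICENSE.
Authors: abc-iut cell, prover seat abc-iut-L4-d2 (gen 6).
-/
import Literature.AnabelianGeometry.AbsoluteAnabelian.ProfiniteVirtualCharts
import HarnessLib

/-!
# Virtual charts II: the commensurator construction (charts extend along open injections)

Sequel to `ProfiniteVirtualCharts.lean` (same hypotheses (NU), (SLIM) on a compact Hausdorff group `Γ`,
spelled out as binders `hNU`, `hslim`; «virtual chart» = a continuous homomorphism `m : P →ₜ* Γ` injective
with open image on some open subgroup, spelled out as `∃ W, IsOpen W ∧ Set.InjOn m W ∧ IsOpen (m '' W)`).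
The topological group theory behind the functoriality of `V⊚(−)` along "open injections of profinite
groups" in [AbsTopIII] Def 5.1 (ii)/(iii) (S. Mochizuki, *Topics in absolute anabelian geometry III*
[MochizukiAbsTopIII2015], pp. 114–115) at the cell's number-field arithmetic shadow.  THEOREMS (proof-only):

* `exists_extension_of_openSubgroup` — the COMMENSURATOR CONSTRUCTION: a continuous injective homomorphism
  `e : V ↪ Γ` with open range from an open subgroup `V ≤ P` of a compact group extends to a continuous
  homomorphism `P →ₜ* Γ` (`p ↦` the unique `τ_p ∈ Γ` inducing `conj(p)` on `e(V ∩ p⁻¹Vp)`; the abstract form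
  of «`Comm(G_F) = G_ℚ`», [NSW] (12.2.1) ff.);
* `exists_chart_extension` — virtual charts EXTEND along open injections `ι : P₁ ↪ P₂` (`m₂ ∘ ι = m₁`).

Together with `chart_comp_of_openInjective` this makes «admits a virtual chart» invariant along every
morphism of `EA⊚` in both directions.  Classical; nothing here bears on [IUTchIII] Cor. 3.12.
-/

namespace Literature.AnabelianGeometry.AbsoluteAnabelian

namespace VirtualChart

universe u v w

section Extension

variable {Γ : Type u} [Group Γ] [TopologicalSpace Γ] [IsTopologicalGroup Γ] [CompactSpace Γ] [T2Space Γ]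
variable {P : Type v} [Group P] [TopologicalSpace P] [IsTopologicalGroup P] [CompactSpace P]

/-- THE COMMENSURATOR CONSTRUCTION.  Let `V ≤ P` be an open subgroup of a compact group and
`e : V →ₜ* Γ` a continuous injective homomorphism with open range.  Under (NU) and (SLIM), `e` extends to
a continuous homomorphism `m : P →ₜ* Γ`: for `p ∈ P`, conjugation by `p` restricts to an isomorphism
between the open subgroups `e(V ∩ p⁻¹Vp)` and `e(V ∩ pVp⁻¹)` of `Γ`, which by (NU) is conjugation by some
`τ_p ∈ Γ`, unique by (SLIM); `p ↦ τ_p` is the extension (the abstract form of «`Comm(G_F) = G_ℚ`»).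
[cite: NeukirchSchmidtWingberg2008, Thm (12.2.1)] -/
theorem exists_extension_of_openSubgroup
    (hNU : ∀ (U₁ U₂ : Subgroup Γ), IsOpen (U₁ : Set Γ) → IsOpen (U₂ : Set Γ) → ∀ α : U₁ ≃ₜ* U₂,
      ∃ τ : Γ, ∀ u : U₁, ((α u : U₂) : Γ) = τ * u * τ⁻¹)
    (hslim : ∀ (U : Subgroup Γ), IsOpen (U : Set Γ) → ∀ x : Γ, (∀ u ∈ U, x * u * x⁻¹ = u) → x = 1)
    {V : Subgroup P} (hV : IsOpen (V : Set P)) (e : V →ₜ* Γ) (he : Function.Injective e)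
    (heo : IsOpen (Set.range e)) :
    ∃ m : P →ₜ* Γ, ∀ v : V, m v = e v := by
  haveI : CompactSpace V := isCompact_iff_compactSpace.mp (V.isClosed_of_isOpen hV).isCompact
  -- images of open subgroups of `V` under `e` are open
  have himg : ∀ S : Subgroup V, IsOpen (S : Set V) → IsOpen (e '' (S : Set V)) := by
    intro S hS
    refine isOpen_image_of_le e (W := ⊤) isOpen_univ he.injOn ?_ hS le_top
    rw [Subgroup.coe_top, Set.image_univ]
    exact heo
  -- the relation «`τ` induces `conj(p)` through `e`» on a subset of `V`
  let Good : P → Γ → Set V → Prop := fun p τ S =>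
    ∀ v w : V, v ∈ S → (p : P) * v * p⁻¹ = w → e w = τ * e v * τ⁻¹
  -- uniqueness on open subgroups
  have huniq : ∀ (p : P) (τ τ' : Γ) (S : Subgroup V), IsOpen (S : Set V) →
      (∀ v ∈ S, (p * v * p⁻¹ : P) ∈ V) → Good p τ S → Good p τ' S → τ = τ' := by
    intro p τ τ' S hS hSV hτ hτ'
    have hUo : IsOpen ((S.map e.toMonoidHom : Subgroup Γ) : Set Γ) := by
      rw [Subgroup.coe_map]; exact himg S hS
    have hx : τ'⁻¹ * τ = 1 := by
      refine hslim _ hUo (τ'⁻¹ * τ) ?_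
      rintro _ ⟨v, hv, rfl⟩
      have h1 := hτ v ⟨p * v * p⁻¹, hSV v hv⟩ hv rfl
      have h2 := hτ' v ⟨p * v * p⁻¹, hSV v hv⟩ hv rfl
      change τ'⁻¹ * τ * e v * (τ'⁻¹ * τ)⁻¹ = e v
      rw [h1] at h2
      -- h2 : τ * e v * τ⁻¹ = τ' * e v * τ'⁻¹
      calc τ'⁻¹ * τ * e v * (τ'⁻¹ * τ)⁻¹ = τ'⁻¹ * (τ * e v * τ⁻¹) * τ' := by group
        _ = τ'⁻¹ * (τ' * e v * τ'⁻¹) * τ' := by rw [h2]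
        _ = e v := by group
    exact (inv_mul_eq_one.mp hx).symm
  -- existence, for every `p`, on the open subgroup `V_p = {v ∈ V | p v p⁻¹ ∈ V}`
  have hex : ∀ p : P, ∃ τ : Γ, Good p τ Set.univ := by
    intro p
    let Vp : Subgroup V := (V.comap (MulAut.conj p).toMonoidHom).subgroupOf V
    have hmemVp : ∀ v : V, v ∈ Vp ↔ (p * v * p⁻¹ : P) ∈ V := fun v => Iff.rfl
    have hVp : IsOpen (Vp : Set V) := by
      have hc : Continuous fun v : V => (p : P) * v * p⁻¹ := by fun_prop
      have : (Vp : Set V) = (fun v : V => (p : P) * v * p⁻¹) ⁻¹' (V : Set P) := rfl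
      rw [this]
      exact hV.preimage hc
    -- conjugation by `p` as a continuous homomorphism `V_p → V`
    let cp : Vp →* V :=
      { toFun := fun v => ⟨p * (v : V) * p⁻¹, (hmemVp v).mp v.2⟩
        map_one' := by ext; simp
        map_mul' := fun a b => by ext; simp [mul_assoc] }
    have hcpc : Continuous cp := by
      refine Continuous.subtype_mk ?_ _
      exact ((continuous_const.mul (continuous_subtype_val.comp continuous_subtype_val)).mul
        continuous_const)
    let cpC : Vp →ₜ* V := { toMonoidHom := cp, continuous_toFun := hcpc }
    have hcp_inj : Function.Injective cpC := by
      intro a b h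
      have h' : (p : P) * (a : V) * p⁻¹ = p * (b : V) * p⁻¹ := congrArg (fun v : V => (v : P)) h
      exact Subtype.ext (Subtype.ext (by simpa using h'))
    -- the local isomorphism `θ : V_p ≃ₜ* e(V_p)`
    obtain ⟨θ, hθ⟩ := exists_localEquiv e hVp he.injOn
    have hUo : IsOpen ((Vp.map e.toMonoidHom : Subgroup Γ) : Set Γ) := by
      rw [Subgroup.coe_map]; exact himg Vp hVp
    -- `φ_p := e ∘ c_p ∘ θ⁻¹ : e(V_p) → Γ`
    let θs : (Vp.map e.toMonoidHom) →ₜ* Vp :=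
      { toMonoidHom := θ.symm.toMulEquiv.toMonoidHom, continuous_toFun := θ.symm.continuous }
    let φ : (Vp.map e.toMonoidHom) →ₜ* Γ := (e.comp cpC).comp θs
    have hφ : Function.Injective φ := he.comp (hcp_inj.comp θ.symm.injective)
    have hφo : IsOpen (Set.range φ) := by
      -- `range φ = e '' {w ∈ V | p⁻¹ w p ∈ V}`
      let Vp' : Subgroup V := (V.comap (MulAut.conj p⁻¹).toMonoidHom).subgroupOf V
      have hmemVp' : ∀ v : V, v ∈ Vp' ↔ (p⁻¹ * v * p⁻¹⁻¹ : P) ∈ V := fun v => Iff.rfl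
      have hVp' : IsOpen (Vp' : Set V) := by
        have hc : Continuous fun v : V => (p⁻¹ : P) * v * p⁻¹⁻¹ := by fun_prop
        have : (Vp' : Set V) = (fun v : V => (p⁻¹ : P) * v * p⁻¹⁻¹) ⁻¹' (V : Set P) := rfl
        rw [this]
        exact hV.preimage hc
      have hrange : Set.range φ = e '' (Vp' : Set V) := by
        ext x
        constructor
        · rintro ⟨u, rfl⟩
          refine ⟨cpC (θs u), ?_, rfl⟩
          change (p⁻¹ * (p * ((θ.symm u : Vp) : V) * p⁻¹) * p⁻¹⁻¹ : P) ∈ V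
          have : (p⁻¹ * (p * ((θ.symm u : Vp) : V) * p⁻¹) * p⁻¹⁻¹ : P) = ((θ.symm u : Vp) : V) := by
            group
          rw [this]
          exact ((θ.symm u : Vp) : V).2
        · rintro ⟨w, hw, rfl⟩
          have hw' : (p⁻¹ * (w : P) * p : P) ∈ V := by
            have := (hmemVp' w).mp hw
            simpa using this
          have hv : (⟨p⁻¹ * (w : P) * p, hw'⟩ : V) ∈ Vp := by
            change (p * (p⁻¹ * (w : P) * p) * p⁻¹ : P) ∈ V
            have : (p * (p⁻¹ * (w : P) * p) * p⁻¹ : P) = w := by group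
            rw [this]; exact w.2
          refine ⟨θ ⟨_, hv⟩, ?_⟩
          change e (cpC (θ.symm (θ ⟨_, hv⟩))) = e w
          rw [θ.symm_apply_apply]
          congr 1
          ext
          change (p * (p⁻¹ * (w : P) * p) * p⁻¹ : P) = w
          group
      rw [hrange]
      exact himg Vp' hVp'
    obtain ⟨τ, hτ⟩ := exists_conj_of_continuous_injective hNU hUo φ hφ hφo
    refine ⟨τ, fun v w _ hvw => ?_⟩
    have hvp : v ∈ Vp := by
      change (p * (v : P) * p⁻¹ : P) ∈ V
      rw [hvw]; exact w.2
    have h := hτ (θ ⟨v, hvp⟩)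
    have h1 : φ (θ ⟨v, hvp⟩) = e (cpC ⟨v, hvp⟩) := by
      change e (cpC (θ.symm (θ ⟨v, hvp⟩))) = _
      rw [θ.symm_apply_apply]
    have h2 : cpC ⟨v, hvp⟩ = w := Subtype.ext hvw
    rw [h1, h2, hθ ⟨v, hvp⟩] at h
    exact h
  -- the extension
  choose m₀ hm₀ using hex
  have hmul : ∀ p q : P, m₀ (p * q) = m₀ p * m₀ q := by
    intro p q
    let S : Subgroup V := (V.comap (MulAut.conj q).toMonoidHom).subgroupOf V ⊓
      (V.comap (MulAut.conj (p * q)).toMonoidHom).subgroupOf V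
    have hS : IsOpen (S : Set V) := by
      have hc1 : Continuous fun v : V => (q : P) * v * q⁻¹ := by fun_prop
      have hc2 : Continuous fun v : V => (p * q : P) * v * (p * q)⁻¹ := by fun_prop
      have : (S : Set V) = (fun v : V => (q : P) * v * q⁻¹) ⁻¹' (V : Set P) ∩
          (fun v : V => (p * q : P) * v * (p * q)⁻¹) ⁻¹' (V : Set P) := rfl
      rw [this]
      exact (hV.preimage hc1).inter (hV.preimage hc2)
    have hSV : ∀ v ∈ S, (p * q * v * (p * q)⁻¹ : P) ∈ V := fun v hv => hv.2
    refine huniq (p * q) _ _ S hS hSV (fun v w hv hvw => hm₀ (p * q) v w trivial hvw) ?_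
    intro v w hv hvw
    have hw₁ : (q * (v : P) * q⁻¹ : P) ∈ V := hv.1
    have h1 : e ⟨q * (v : P) * q⁻¹, hw₁⟩ = m₀ q * e v * (m₀ q)⁻¹ := hm₀ q v _ trivial rfl
    have h2 : e w = m₀ p * e ⟨q * (v : P) * q⁻¹, hw₁⟩ * (m₀ p)⁻¹ := by
      refine hm₀ p _ w trivial ?_
      change (p * (q * (v : P) * q⁻¹) * p⁻¹ : P) = w
      rw [← hvw]; group
    rw [h2, h1]; group
  have hagree : ∀ v : V, m₀ v = e v := by
    intro v₀
    refine huniq (v₀ : P) _ _ ⊤ isOpen_univ (fun v _ => ?_) (fun v w _ hvw => hm₀ v₀ v w trivial hvw) ?_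
    · exact V.mul_mem (V.mul_mem v₀.2 v.2) (V.inv_mem v₀.2)
    · intro v w _ hvw
      have : w = v₀ * v * v₀⁻¹ := Subtype.ext (by simpa using hvw.symm)
      rw [this, map_mul, map_mul, map_inv]
  let mh : P →* Γ := MonoidHom.mk' m₀ hmul
  have hcont : Continuous mh := by
    refine continuous_of_continuousAt_one mh ?_
    have hVn : (V : Set P) ∈ nhds (1 : P) := hV.mem_nhds V.one_mem
    have hon : ContinuousOn mh (V : Set P) := by
      rw [continuousOn_iff_continuous_restrict]
      have : (V : Set P).restrict mh = fun v : V => e v := funext fun v => hagree v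
      rw [this]
      exact e.continuous
    exact hon.continuousAt hVn
  exact ⟨{ toMonoidHom := mh, continuous_toFun := hcont }, hagree⟩

end Extension

section ChartExtension

variable {Γ : Type u} [Group Γ] [TopologicalSpace Γ] [IsTopologicalGroup Γ] [CompactSpace Γ] [T2Space Γ]
variable {P₁ : Type v} [Group P₁] [TopologicalSpace P₁] [IsTopologicalGroup P₁] [CompactSpace P₁]
variable {P₂ : Type w} [Group P₂] [TopologicalSpace P₂] [IsTopologicalGroup P₂] [CompactSpace P₂]
  [T2Space P₂]

/-- Virtual charts EXTEND along open injections: if `ι : P₁ ↪ P₂` is a continuous injection with open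
range and `m₁` a virtual chart of `P₁`, then there is a virtual chart `m₂` of `P₂` with `m₂ ∘ ι = m₁`.
[cite: MochizukiAbsTopIII2015, Def 5.1 (iii) p.115] -/
theorem exists_chart_extension
    (hNU : ∀ (U₁ U₂ : Subgroup Γ), IsOpen (U₁ : Set Γ) → IsOpen (U₂ : Set Γ) → ∀ α : U₁ ≃ₜ* U₂,
      ∃ τ : Γ, ∀ u : U₁, ((α u : U₂) : Γ) = τ * u * τ⁻¹)
    (hslim : ∀ (U : Subgroup Γ), IsOpen (U : Set Γ) → ∀ x : Γ, (∀ u ∈ U, x * u * x⁻¹ = u) → x = 1)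
    (ι : P₁ →ₜ* P₂) (hι : Function.Injective ι) (hιo : IsOpen (Set.range ι)) (m₁ : P₁ →ₜ* Γ)
    (hm₁ : ∃ W : Subgroup P₁, IsOpen (W : Set P₁) ∧ Set.InjOn m₁ W ∧ IsOpen (m₁ '' W)) :
    ∃ m₂ : P₂ →ₜ* Γ, (∃ W : Subgroup P₂, IsOpen (W : Set P₂) ∧ Set.InjOn m₂ W ∧ IsOpen (m₂ '' W)) ∧
      ∀ x : P₁, m₂ (ι x) = m₁ x := by
  obtain ⟨W₁, hW₁, hinj₁, hop₁⟩ := hm₁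
  -- `V := ι(W₁)`, an open subgroup of `P₂`, and `θ : W₁ ≃ₜ* V`
  have hVo : IsOpen ((W₁.map ι.toMonoidHom : Subgroup P₂) : Set P₂) := by
    rw [Subgroup.coe_map]
    refine isOpen_image_of_le ι (W := ⊤) isOpen_univ hι.injOn ?_ hW₁ le_top
    rw [Subgroup.coe_top, Set.image_univ]; exact hιo
  obtain ⟨θ, hθ⟩ := exists_localEquiv ι hW₁ hι.injOn
  let incl : W₁ →ₜ* P₁ := { toMonoidHom := W₁.subtype, continuous_toFun := continuous_subtype_val }
  let θs : (W₁.map ι.toMonoidHom) →ₜ* W₁ :=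
    { toMonoidHom := θ.symm.toMulEquiv.toMonoidHom, continuous_toFun := θ.symm.continuous }
  let e : (W₁.map ι.toMonoidHom) →ₜ* Γ := (m₁.comp incl).comp θs
  have he_apply : ∀ w : W₁, e (θ w) = m₁ w := by
    intro w
    change m₁ ((θ.symm (θ w) : W₁) : P₁) = m₁ w
    rw [θ.symm_apply_apply]
  have he : Function.Injective e := by
    intro a b h
    obtain ⟨a', rfl⟩ := θ.surjective a
    obtain ⟨b', rfl⟩ := θ.surjective b
    rw [he_apply, he_apply] at h
    have : (a' : P₁) = b' := hinj₁ a'.2 b'.2 h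
    rw [Subtype.ext this]
  have heo : IsOpen (Set.range e) := by
    have : Set.range e = m₁ '' (W₁ : Set P₁) := by
      ext x
      constructor
      · rintro ⟨a, rfl⟩
        obtain ⟨a', rfl⟩ := θ.surjective a
        exact ⟨a', a'.2, (he_apply a').symm⟩
      · rintro ⟨w, hw, rfl⟩
        exact ⟨θ ⟨w, hw⟩, he_apply ⟨w, hw⟩⟩
    rw [this]; exact hop₁
  obtain ⟨m₂, hm₂⟩ := exists_extension_of_openSubgroup hNU hslim hVo e he heo
  -- `m₂ ∘ ι = m₁` on `W₁`, hence everywhere by rigidity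
  have hagree : ∀ w ∈ W₁, (m₂.comp ι) w = 1 * m₁ w * 1⁻¹ := by
    intro w hw
    have h1 : (m₂.comp ι) w = m₂ ((θ ⟨w, hw⟩ : W₁.map ι.toMonoidHom) : P₂) := by
      change m₂ (ι w) = _
      rw [hθ ⟨w, hw⟩]
    rw [h1, hm₂, he_apply]
    simp
  have hinj' : Set.InjOn (m₂.comp ι) W₁ := by
    intro a ha b hb h
    rw [hagree a ha, hagree b hb] at h
    exact hinj₁ ha hb (by simpa using h)
  have hop' : IsOpen ((m₂.comp ι) '' (W₁ : Set P₁)) := by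
    have : (m₂.comp ι) '' (W₁ : Set P₁) = m₁ '' (W₁ : Set P₁) := by
      refine Set.image_congr fun w hw => ?_
      rw [hagree w hw]; group
    rw [this]; exact hop₁
  have hall := conj_of_conj_on_open hslim m₁.toMonoidHom (m₂.comp ι) hW₁ hinj' hop' hagree
  refine ⟨m₂, ⟨W₁.map ι.toMonoidHom, hVo, ?_, ?_⟩, fun x => ?_⟩
  · rintro _ ⟨a, ha, rfl⟩ _ ⟨b, hb, rfl⟩ h
    change m₂ (ι a) = m₂ (ι b) at h
    have := hinj' ha hb h
    rw [this]
  · have : m₂ '' ((W₁.map ι.toMonoidHom : Subgroup P₂) : Set P₂) = Set.range e := by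
      rw [Subgroup.coe_map]
      ext x
      constructor
      · rintro ⟨_, ⟨w, hw, rfl⟩, rfl⟩
        refine ⟨θ ⟨w, hw⟩, ?_⟩
        rw [← hm₂, hθ ⟨w, hw⟩]
        rfl
      · rintro ⟨a, rfl⟩
        exact ⟨(a : P₂), a.2, hm₂ a⟩
    rw [this]; exact heo
  · have := hall x
    simpa using this

end ChartExtension

end VirtualChart

end Literature.AnabelianGeometry.AbsoluteAnabelian
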